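import Literature.MathematicalPhysics.AQFT.ModularData
import Literature.MathematicalPhysics.AQFT.TomitaCommutationLemma
import Literature.Analysis.OperatorTheory.ModularAnalyticFamily
import Literature.Analysis.Fourier.CoshKernelInjective
import HarnessLib

/-!
# Proof of `TomitaTakesaki_exists_modularData` (Haag, Thm. V.2.1.1): Tomita's theorem for a
# von Neumann algebra with a cyclic and separating vector (Rieffel–van Daele, §4)

This file discharges the named fact
`Literature.MathematicalPhysics.AQFT.TomitaTakesaki_exists_modularData` of
`Literature.MathematicalPhysics.AQFT.ModularData` (`TomitaTakesaki_exists_modularData_holds`).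

Let `M` be a von Neumann algebra on `H` with cyclic and separating vector `Ω`, `𝒦 = closure(M_sa Ω)`
(`tomitaK`), `J` the conjugation of the standard subspace `𝒦` (`tomitaJ`), `Δ^{it}` its modular
group (`modU 𝒦 t`) and `σ_t(X) = Δ^{it} X Δ^{−it}`. Following Rieffel–van Daele
(*A bounded operator approach to Tomita–Takesaki theory*, Pacific J. Math. 69 (1977), §4) we prove:

* **Lemma 4.7** (`integral_formula`): for `x' ∈ M'_s`, `−π < φ < π` and the `x ∈ M_s` of Lemma 4.5
  (`commutation_lemma_sa`, with `λ = e^{iφ/2}`),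
  `x = ∫ e^{−φt}/(e^{πt} + e^{−πt}) Δ^{it} J x' J Δ^{−it} dt` (weakly: all matrix elements), from
  the integral identity of `Literature.Analysis.OperatorTheory.ModularAnalyticFamily` (their
  function `f(z) = ⟨R^{−z+1/2}(2−R)^{z+1/2} x R^{z+1/2}(2−R)^{−z+1/2}ξ, η⟩` and Lemma 4.6) and
  "the fact that `T` is injective and so has dense range";
* **Lemma 4.8** (`modU_conj_conjJ_mem`): `Δ^{it} J x' J Δ^{−it} ∈ M` for `x' ∈ M'` and real `t`
  ("`y'` commutes with the right hand side … `g(t) = ⟨y'Δ^{it}Jx'JΔ^{−it}ξ, η⟩ − ⟨Δ^{it}Jx'JΔ^{−it}y'ξ, η⟩`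
  … `∫ g(t) e^{−φt}/(e^{πt}+e^{−πt}) dt = 0` for all `φ` with `−π < φ < π`. But then `g` itself must
  vanish" — by `Literature.Analysis.Fourier.eq_zero_of_forall_integral_coshKernel_eq_zero` — and
  the double commutant theorem); in particular `J M' J ⊆ M` (`conjJ_mem`);
* **Lemma 4.9** (`conjJ_mem_commutant`): `J M J ⊆ M'`, by their direct algebraic verification
  (`Jω = ω`; `⟨Jxω, yω⟩` is real for `x, y ∈ M_s`; `(y(JxJ)ω, ω) = (ω, x(JyJ)ω)`, extended by
  linearity, `y ↦ y(Jy'J)`, cyclicity of `ω` for `M'` and for `M`);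
* **Theorem 4.2** (`modU_conj_mem`, `modU_conj_mem_commutant`): `JMJ = M'` and `Δ^{it} M Δ^{−it} = M`;
* the **modular (KMS) condition** for `ω = ⟨Ω, ·Ω⟩` and `σ_t` on `M` (their Thm. 4.10, from
  Prop. 3.7 = `Literature.Analysis.OperatorTheory.kmsFun` by polarisation: "for any `x, y ∈ M_s`
  we have the pair of vectors `(xω, yω)` in `𝒦`, to which there corresponds a K.M.S. function …
  By linearity it follows that for all `x, y ∈ M` there is a K.M.S. function"), `kms_of_mem`;
and assemble the `ModularData M Ω` of `Literature.MathematicalPhysics.AQFT.ModularData`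
(`exists_modularData`): `U(t) = Δ^{it}`, `J`, with `Δ^{it}Ω = Ω = JΩ`, `JΔ^{it} = Δ^{it}J`,
`Δ^{it}MΔ^{−it} = M`, `Δ^{it}M'Δ^{−it} = M'`, `JMJ ⊆ M'`, `JM'J ⊆ M` and the KMS condition — i.e.
Haag's Thm. V.2.1.1 with (V.2.6), (V.2.9), (V.2.14).

Conventions: Mathlib's inner product is conjugate-linear in the first variable, so R–vD's
`⟨a, b⟩` is our `⟪b, a⟫`, and their `λ` of Lemma 4.5 is our `conj μ`.

## References
* M. A. Rieffel, A. van Daele, *A bounded operator approach to Tomita–Takesaki theory*, Pacific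
  J. Math. 69 (1977) 187–221, §4. [RieffelVandaele1977]
* R. Haag, *Local Quantum Physics*, 2nd ed., Springer 1996, V.2.1, Thm. 2.1.1. [Haag1996]
-/

noncomputable section

open Complex ContinuousLinearMap MeasureTheory Filter Set
open _root_.Topology
open scoped InnerProductSpace ComplexConjugate Real

set_option synthInstance.maxHeartbeats 200000

namespace Literature.MathematicalPhysics.AQFT

open Literature.Analysis.OperatorTheory
open Literature.Analysis.Complex (weight abs_weight_le integrable_exp_neg_mul_abs)


variable {H : Type*} [NormedAddCommGroup H] [InnerProductSpace ℂ H] [CompleteSpace H]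

/-! ### The weight `W_φ` -/

omit [CompleteSpace H] in
/-- `W_φ` is continuous. [folklore] -/
theorem continuous_weight (φ : ℝ) : Continuous (weight φ) := by
  unfold weight
  exact (by fun_prop : Continuous fun t => Real.exp (-(φ * t))).div (by fun_prop) fun t => by positivity

omit [CompleteSpace H] in
/-- `W_φ g` is integrable for `g` continuous and bounded, `|φ| < π`. [cite: RieffelVandaele1977, Lemma 4.6] -/
theorem integrable_weight_mul {φ : ℝ} (hφ : |φ| < π) {g : ℝ → ℂ} (hg : Continuous g) {C : ℝ}
    (hC : ∀ t, ‖g t‖ ≤ C) : Integrable fun t => (weight φ t : ℂ) * g t := by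
  refine Integrable.mono' ((integrable_exp_neg_mul_abs (sub_pos.2 hφ)).mul_const C)
    ((Complex.continuous_ofReal.comp (continuous_weight φ)).mul hg).aestronglyMeasurable
    (Eventually.of_forall fun t => ?_)
  rw [norm_mul, Complex.norm_real, Real.norm_eq_abs]
  exact mul_le_mul (abs_weight_le φ t) (hC t) (norm_nonneg _) (Real.exp_pos _).le

omit [CompleteSpace H] in
/-- **Joint continuity of `(a, b) ↦ ∫ W_φ(t) ⟪a, Y_t b⟫ dt`** for a strongly continuous bounded
family `Y`. [folklore] -/
theorem continuous_integral_weight_inner {φ : ℝ} (hφ : |φ| < π) {Y : ℝ → H →L[ℂ] H} {C : ℝ}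
    (hY : ∀ b, Continuous fun t => Y t b) (hC : ∀ t, ‖Y t‖ ≤ C) :
    Continuous fun p : H × H => ∫ t : ℝ, (weight φ t : ℂ) * ⟪p.1, Y t p.2⟫_ℂ := by
  have hC0 : 0 ≤ C := (norm_nonneg _).trans (hC 0)
  refine continuous_iff_continuousAt.2 fun p₀ => ?_
  have hmeas : ∀ p : H × H,
      AEStronglyMeasurable (fun t => (weight φ t : ℂ) * ⟪p.1, Y t p.2⟫_ℂ) volume := fun p =>
    ((Complex.continuous_ofReal.comp (continuous_weight φ)).mul
      (continuous_const.inner (hY p.2))).aestronglyMeasurable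
  refine continuousAt_of_dominated
    (bound := fun t => Real.exp (-(π - |φ|) * |t|) * ((‖p₀.1‖ + 1) * (C * (‖p₀.2‖ + 1))))
    (Eventually.of_forall hmeas) ?_ ?_ ?_
  · filter_upwards [Metric.ball_mem_nhds p₀ one_pos] with p hp
    rw [Metric.mem_ball, Prod.dist_eq, max_lt_iff, dist_eq_norm, dist_eq_norm] at hp
    have hp1 : ‖p.1‖ ≤ ‖p₀.1‖ + 1 := (norm_le_insert' _ _).trans (by linarith [hp.1])
    have hp2 : ‖p.2‖ ≤ ‖p₀.2‖ + 1 := (norm_le_insert' _ _).trans (by linarith [hp.2])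
    refine Eventually.of_forall fun t => ?_
    rw [norm_mul, Complex.norm_real, Real.norm_eq_abs]
    refine mul_le_mul (abs_weight_le φ t) ?_ (norm_nonneg _) (Real.exp_pos _).le
    calc ‖⟪p.1, Y t p.2⟫_ℂ‖ ≤ ‖p.1‖ * ‖Y t p.2‖ := norm_inner_le_norm _ _
      _ ≤ (‖p₀.1‖ + 1) * (C * (‖p₀.2‖ + 1)) :=
          mul_le_mul hp1 ((le_opNorm _ _).trans (mul_le_mul (hC t) hp2 (norm_nonneg _) hC0))
            (norm_nonneg _) (by positivity)
  · exact (integrable_exp_neg_mul_abs (sub_pos.2 hφ)).mul_const _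
  · refine Eventually.of_forall fun t => ?_
    exact (continuous_const.mul (continuous_fst.inner ((Y t).continuous.comp continuous_snd))).continuousAt

/-! ### `σ_t(X) = Δ^{it} X Δ^{−it}` -/

section Conj

variable (M : VonNeumannAlgebra H) (Ω : H)

/-- `‖Δ^{it} X Δ^{−it} b‖ ≤ ‖X‖ ‖b‖`. [folklore] -/
theorem norm_modU_conj_apply_le (t : ℝ) (X : H →L[ℂ] H) (b : H) :
    ‖(modU (tomitaK M Ω) t * X * modU (tomitaK M Ω) (-t)) b‖ ≤ ‖X‖ * ‖b‖ := by
  rw [mul_apply_eq_comp, mul_apply_eq_comp, norm_modU_apply]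
  exact (le_opNorm _ _).trans (by rw [norm_modU_apply])

/-- `‖Δ^{it} X Δ^{−it}‖ ≤ ‖X‖`. [folklore] -/
theorem norm_modU_conj_le (t : ℝ) (X : H →L[ℂ] H) :
    ‖modU (tomitaK M Ω) t * X * modU (tomitaK M Ω) (-t)‖ ≤ ‖X‖ :=
  opNorm_le_bound _ (norm_nonneg _) (norm_modU_conj_apply_le M Ω t X)

/-- `t ↦ Δ^{it} X Δ^{−it} b` is continuous. [folklore] -/
theorem continuous_modU_conj_apply (X : H →L[ℂ] H) (b : H) :
    Continuous fun t => (modU (tomitaK M Ω) t * X * modU (tomitaK M Ω) (-t)) b := by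
  simp only [mul_apply_eq_comp]
  have h1 : Continuous fun t : ℝ => X (modU (tomitaK M Ω) (-t) b) :=
    X.continuous.comp ((continuous_modU_apply (tomitaK M Ω) b).comp continuous_neg)
  exact continuous_apply_of_strongly_continuous (C := 1) (continuous_modU_apply (tomitaK M Ω))
    (fun t => opNorm_le_bound _ zero_le_one fun ψ => by rw [norm_modU_apply, one_mul]) h1

end Conj

variable {M : VonNeumannAlgebra H} {Ω : H} (hstd : IsStandardVector M Ω)

/-! ### Lemma 4.7: the integral formula -/

/-- `Re e^{−iφ/2} = cos(φ/2) > 0` for `|φ| < π`. [folklore] -/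
theorem re_exp_neg_I_half_pos {φ : ℝ} (hφ : |φ| < π) : 0 < (Complex.exp (-(I * (φ / 2)))).re := by
  have hφ' := abs_lt.1 hφ
  rw [Complex.exp_re]
  have hre : (-(I * ((φ : ℂ) / 2))).re = 0 := by simp
  have him : (-(I * ((φ : ℂ) / 2))).im = -(φ / 2) := by simp
  rw [hre, him, Real.exp_zero, one_mul, Real.cos_neg]
  exact Real.cos_pos_of_mem_Ioo ⟨by linarith, by linarith⟩

omit [CompleteSpace H] in
/-- `conj e^{−iφ/2} = e^{iφ/2}`. [folklore] -/
theorem conj_exp_neg_I_half (φ : ℝ) : conj (Complex.exp (-(I * (φ / 2)))) = Complex.exp (I * (φ / 2)) := by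
  rw [← Complex.exp_conj]
  congr 1
  simp [map_neg, map_mul, Complex.conj_I, map_div₀, Complex.conj_ofReal, map_ofNat]

include hstd in
/-- **Lemma 4.7 on the range of `T`**: with `x ∈ M_s` from Lemma 4.5 (`λ = e^{iφ/2}`),
`⟪Tη, x Tξ⟫ = ∫ W_φ(t) ⟪Tη, Δ^{it}Jx'JΔ^{−it} Tξ⟫ dt`. [cite: RieffelVandaele1977, Lemma 4.7] -/
theorem integral_formula_modT {x' : H →L[ℂ] H} (hx'M : x' ∈ M.commutant) (hsa' : IsSelfAdjoint x')
    {φ : ℝ} (hφ : |φ| < π) :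
    ∃ x ∈ M, IsSelfAdjoint x ∧ ∀ ξ η : H, ⟪modT (tomitaK M Ω) η, x (modT (tomitaK M Ω) ξ)⟫_ℂ =
      ∫ t : ℝ, (weight φ t : ℂ) *
        ⟪modT (tomitaK M Ω) η, (modU (tomitaK M Ω) t * (conjJ hstd x') * modU (tomitaK M Ω) (-t)) (modT (tomitaK M Ω) ξ)⟫_ℂ := by
  obtain ⟨x, hxM, hxsa, h45⟩ := commutation_lemma_sa hstd hx'M hsa' (re_exp_neg_I_half_pos hφ)
  refine ⟨x, hxM, hxsa, fun ξ η => ?_⟩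
  have hT : IsSelfAdjoint (modT (tomitaK M Ω)) := modT_isSelfAdjoint (tomitaK M Ω)
  have hTa : ∀ u v : H, ⟪u, modT (tomitaK M Ω) v⟫_ℂ = ⟪modT (tomitaK M Ω) u, v⟫_ℂ := fun u v => by
    rw [← adjoint_inner_left, ← star_eq_adjoint, hT.star_eq]
  have h := inner_modT_apply_modT_eq_integral (tomitaK M Ω) (tomitaK_sep M Ω hstd) (tomitaK_dense M Ω hstd) x ξ η hφ
  rw [hTa] at h
  rw [h]
  congr 1
  funext t
  have hcomb : Complex.exp (I * (φ / 2)) * ⟪η, (modU (tomitaK M Ω) t * ((2 - modR (tomitaK M Ω)) * x * modR (tomitaK M Ω)) * modU (tomitaK M Ω) (-t)) ξ⟫_ℂ +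
      Complex.exp (-(I * (φ / 2))) * ⟪η, (modU (tomitaK M Ω) t * (modR (tomitaK M Ω) * x * (2 - modR (tomitaK M Ω))) * modU (tomitaK M Ω) (-t)) ξ⟫_ℂ =
      ⟪η, (modU (tomitaK M Ω) t * (modT (tomitaK M Ω) * conjJ hstd x' * modT (tomitaK M Ω)) * modU (tomitaK M Ω) (-t)) ξ⟫_ℂ := by
    rw [h45, ← conj_exp_neg_I_half φ]
    simp only [mul_add, add_mul, mul_smul_comm, smul_mul_assoc, add_apply, smul_apply,
      inner_add_right, inner_smul_right]
  rw [hcomb]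
  congr 1
  have hc1 : modU (tomitaK M Ω) t * modT (tomitaK M Ω) = modT (tomitaK M Ω) * modU (tomitaK M Ω) t := (modT_commute_modU (tomitaK M Ω) t).eq.symm
  have hc2 : modT (tomitaK M Ω) * modU (tomitaK M Ω) (-t) = modU (tomitaK M Ω) (-t) * modT (tomitaK M Ω) := (modT_commute_modU (tomitaK M Ω) (-t)).eq
  have hop : modU (tomitaK M Ω) t * (modT (tomitaK M Ω) * conjJ hstd x' * modT (tomitaK M Ω)) * modU (tomitaK M Ω) (-t) =
      modT (tomitaK M Ω) * (modU (tomitaK M Ω) t * (conjJ hstd x') * modU (tomitaK M Ω) (-t)) * modT (tomitaK M Ω) := by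
    simp only [← mul_assoc]
    rw [hc1, mul_assoc (modT (tomitaK M Ω) * modU (tomitaK M Ω) t * conjJ hstd x'), hc2, ← mul_assoc]
  rw [hop, mul_apply_eq_comp, mul_apply_eq_comp, hTa]

include hstd in
/-- **Lemma 4.7 (weak form on all vectors)**: for `x' ∈ M'_s` and `|φ| < π` there is `x ∈ M_s` with
`⟪a, x b⟫ = ∫ W_φ(t) ⟪a, Δ^{it} J x' J Δ^{−it} b⟫ dt` for all `a, b` — "`T` is injective and so has
dense range". [cite: RieffelVandaele1977, Lemma 4.7] -/
theorem integral_formula {x' : H →L[ℂ] H} (hx'M : x' ∈ M.commutant) (hsa' : IsSelfAdjoint x')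
    {φ : ℝ} (hφ : |φ| < π) :
    ∃ x ∈ M, IsSelfAdjoint x ∧ ∀ a b : H, ⟪a, x b⟫_ℂ =
      ∫ t : ℝ, (weight φ t : ℂ) * ⟪a, (modU (tomitaK M Ω) t * (conjJ hstd x') * modU (tomitaK M Ω) (-t)) b⟫_ℂ := by
  obtain ⟨x, hxM, hxsa, hx⟩ := integral_formula_modT hstd hx'M hsa' hφ
  refine ⟨x, hxM, hxsa, ?_⟩
  set X := conjJ hstd x'
  have hd : DenseRange (modT (tomitaK M Ω)) := dense_range_modT (tomitaK M Ω) (tomitaK_sep M Ω hstd) (tomitaK_dense M Ω hstd)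
  have hcont : Continuous fun p : H × H => ∫ t : ℝ, (weight φ t : ℂ) * ⟪p.1, (modU (tomitaK M Ω) t * X * modU (tomitaK M Ω) (-t)) p.2⟫_ℂ :=
    continuous_integral_weight_inner hφ (Y := fun t => (modU (tomitaK M Ω) t * X * modU (tomitaK M Ω) (-t))) (continuous_modU_conj_apply M Ω X)
      (norm_modU_conj_le M Ω · X)
  have h1 : ∀ ξ a : H, ⟪a, x (modT (tomitaK M Ω) ξ)⟫_ℂ = ∫ t, (weight φ t : ℂ) * ⟪a, (modU (tomitaK M Ω) t * X * modU (tomitaK M Ω) (-t)) (modT (tomitaK M Ω) ξ)⟫_ℂ := by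
    intro ξ
    have heq := hd.equalizer (g := fun a => ⟪a, x (modT (tomitaK M Ω) ξ)⟫_ℂ)
      (h := fun a => ∫ t, (weight φ t : ℂ) * ⟪a, (modU (tomitaK M Ω) t * X * modU (tomitaK M Ω) (-t)) (modT (tomitaK M Ω) ξ)⟫_ℂ) (by fun_prop)
      (hcont.comp (continuous_id.prodMk continuous_const)) (funext fun η => hx ξ η)
    exact fun a => congrFun heq a
  intro a
  have heq := hd.equalizer (g := fun b => ⟪a, x b⟫_ℂ)
    (h := fun b => ∫ t, (weight φ t : ℂ) * ⟪a, (modU (tomitaK M Ω) t * X * modU (tomitaK M Ω) (-t)) b⟫_ℂ) (by fun_prop)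
    (hcont.comp (continuous_const.prodMk continuous_id)) (funext fun ξ => h1 ξ a)
  exact fun b => congrFun heq b

/-! ### Lemma 4.8: `Δ^{it} J M' J Δ^{−it} ⊆ M` -/

/-- **Lemma 4.8 for self-adjoint `x' ∈ M'`**: `Δ^{it} J x' J Δ^{−it} ∈ M`.
[cite: RieffelVandaele1977, Lemma 4.8] -/
theorem modU_conj_conjJ_mem_of_sa {x' : H →L[ℂ] H} (hx'M : x' ∈ M.commutant) (hsa' : IsSelfAdjoint x')
    (t : ℝ) : (modU (tomitaK M Ω) t * (conjJ hstd x') * modU (tomitaK M Ω) (-t)) ∈ M := by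
  set X := conjJ hstd x' with hX
  rw [VonNeumannAlgebra.mem_iff_forall_commute]
  intro y' hy'M
  -- `g(s) = ⟪a, y'σ_s(X)b⟫ − ⟪a, σ_s(X)y'b⟫` vanishes identically
  have hzero : ∀ a b : H,
      (fun s => ⟪a, y' ((modU (tomitaK M Ω) s * X * modU (tomitaK M Ω) (-s)) b)⟫_ℂ - ⟪a, (modU (tomitaK M Ω) s * X * modU (tomitaK M Ω) (-s)) (y' b)⟫_ℂ) = 0 := by
    intro a b
    have hgc : Continuous fun s => ⟪a, y' ((modU (tomitaK M Ω) s * X * modU (tomitaK M Ω) (-s)) b)⟫_ℂ - ⟪a, (modU (tomitaK M Ω) s * X * modU (tomitaK M Ω) (-s)) (y' b)⟫_ℂ :=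
      (continuous_const.inner (y'.continuous.comp (continuous_modU_conj_apply M Ω X b))).sub
        (continuous_const.inner (continuous_modU_conj_apply M Ω X (y' b)))
    have hgb : ∀ s, ‖⟪a, y' ((modU (tomitaK M Ω) s * X * modU (tomitaK M Ω) (-s)) b)⟫_ℂ - ⟪a, (modU (tomitaK M Ω) s * X * modU (tomitaK M Ω) (-s)) (y' b)⟫_ℂ‖ ≤
        ‖a‖ * (‖y'‖ * (‖X‖ * ‖b‖)) + ‖a‖ * (‖X‖ * (‖y'‖ * ‖b‖)) := fun s => by
      refine (norm_sub_le _ _).trans (add_le_add ?_ ?_)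
      · refine (norm_inner_le_norm _ _).trans (mul_le_mul_of_nonneg_left ?_ (norm_nonneg _))
        exact (le_opNorm _ _).trans (mul_le_mul_of_nonneg_left (norm_modU_conj_apply_le M Ω s X b) (norm_nonneg _))
      · refine (norm_inner_le_norm _ _).trans (mul_le_mul_of_nonneg_left ?_ (norm_nonneg _))
        exact (norm_modU_conj_apply_le M Ω s X _).trans (mul_le_mul_of_nonneg_left (le_opNorm _ _) (norm_nonneg _))
    refine Literature.Analysis.Fourier.eq_zero_of_forall_integral_coshKernel_eq_zero hgc hgb fun φ hφ => ?_
    obtain ⟨x, hxM, -, hx⟩ := integral_formula hstd hx'M hsa' hφ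
    have hi1 : Integrable fun s => (weight φ s : ℂ) * ⟪adjoint y' a, (modU (tomitaK M Ω) s * X * modU (tomitaK M Ω) (-s)) b⟫_ℂ :=
      integrable_weight_mul hφ (continuous_const.inner (continuous_modU_conj_apply M Ω X b))
        (C := ‖adjoint y' a‖ * (‖X‖ * ‖b‖))
        (fun s => (norm_inner_le_norm _ _).trans (mul_le_mul_of_nonneg_left (norm_modU_conj_apply_le M Ω s X b) (norm_nonneg _)))
    have hi2 : Integrable fun s => (weight φ s : ℂ) * ⟪a, (modU (tomitaK M Ω) s * X * modU (tomitaK M Ω) (-s)) (y' b)⟫_ℂ :=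
      integrable_weight_mul hφ (continuous_const.inner (continuous_modU_conj_apply M Ω X (y' b)))
        (C := ‖a‖ * (‖X‖ * ‖y' b‖))
        (fun s => (norm_inner_le_norm _ _).trans (mul_le_mul_of_nonneg_left (norm_modU_conj_apply_le M Ω s X _) (norm_nonneg _)))
    calc ∫ s, (weight φ s : ℂ) * (⟪a, y' ((modU (tomitaK M Ω) s * X * modU (tomitaK M Ω) (-s)) b)⟫_ℂ - ⟪a, (modU (tomitaK M Ω) s * X * modU (tomitaK M Ω) (-s)) (y' b)⟫_ℂ)
        = ∫ s, ((weight φ s : ℂ) * ⟪adjoint y' a, (modU (tomitaK M Ω) s * X * modU (tomitaK M Ω) (-s)) b⟫_ℂ -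
            (weight φ s : ℂ) * ⟪a, (modU (tomitaK M Ω) s * X * modU (tomitaK M Ω) (-s)) (y' b)⟫_ℂ) := by
          congr 1; funext s; rw [mul_sub, adjoint_inner_left]
      _ = ⟪adjoint y' a, x b⟫_ℂ - ⟪a, x (y' b)⟫_ℂ := by rw [integral_sub hi1 hi2, ← hx, ← hx]
      _ = 0 := by rw [adjoint_inner_left, commutant_apply_comm hxM hy'M, sub_self]
  ext b
  refine ext_inner_left ℂ fun a => ?_
  have h := congrFun (hzero a b) t
  simp only [Pi.zero_apply, sub_eq_zero] at h
  exact h.symm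

/-- **Lemma 4.8**: `Δ^{it} J x' J Δ^{−it} ∈ M` for every `x' ∈ M'` and real `t`.
[cite: RieffelVandaele1977, Lemma 4.8] -/
theorem modU_conj_conjJ_mem {x' : H →L[ℂ] H} (hx'M : x' ∈ M.commutant) (t : ℝ) :
    (modU (tomitaK M Ω) t * (conjJ hstd x') * modU (tomitaK M Ω) (-t)) ∈ M := by
  obtain ⟨a₁, a₂, h1M, h2M, h1sa, h2sa, hdec, -⟩ := exists_sa_decomp M.commutant hx'M
  have h1 := modU_conj_conjJ_mem_of_sa hstd h1M h1sa t
  have h2 := modU_conj_conjJ_mem_of_sa hstd h2M h2sa t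
  rw [hdec, conjJ_add, conjJ_smul, mul_add, add_mul, mul_smul_comm, smul_mul_assoc]
  exact add_mem h1 (M.toStarSubalgebra.smul_mem h2 _)

/-- **`J M' J ⊆ M`** (Lemma 4.8 at `t = 0`). [cite: RieffelVandaele1977, Lemma 4.8] -/
theorem conjJ_mem {x' : H →L[ℂ] H} (hx'M : x' ∈ M.commutant) : conjJ hstd x' ∈ M := by
  simpa [modU_zero] using modU_conj_conjJ_mem hstd hx'M 0

/-! ### Lemma 4.9: `J M J ⊆ M'` -/

/-- **`J Ω = Ω`** ("`Rω = ω = TJω` and `Tω = ω`"). [cite: RieffelVandaele1977, Lemma 4.9 (proof)] -/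
theorem tomitaJ_self : tomitaJ M Ω hstd Ω = Ω := by
  have h := tomitaJ_modT hstd Ω
  rw [modT_tomitaK_self] at h
  rw [h, modB_tomitaK_self]

/-- `(J x J) Ω = J (x Ω)`. [cite: RieffelVandaele1977, Lemma 4.9 (proof)] -/
theorem conjJ_apply_self (x : H →L[ℂ] H) : conjJ hstd x Ω = tomitaJ M Ω hstd (x Ω) := by
  rw [conjJ_apply, tomitaJ_self]

/-- **`⟨Jξ, η⟩` is real for `ξ, η ∈ 𝒦`** (`J𝒦 = i𝒦^⊥`): `⟪η, Jξ⟫ = ⟪Jξ, η⟫`.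
[cite: RieffelVandaele1977, Lemma 4.9 (proof)] -/
theorem inner_tomitaJ_of_mem {ξ η : H} (hξ : ξ ∈ tomitaK M Ω) (hη : η ∈ tomitaK M Ω) :
    ⟪η, tomitaJ M Ω hstd ξ⟫_ℂ = ⟪tomitaJ M Ω hstd ξ, η⟫_ℂ := by
  letI : InnerProductSpace ℝ H := Literature.Analysis.OperatorTheory.realIPS
  set K := tomitaK M Ω with hK
  -- `Q (J ξ) = 0`
  have hQ : (mulI K).starProjection (tomitaJ M Ω hstd ξ) = 0 := by
    have h := modJ_starProjection K (tomitaK_sep M Ω hstd) (tomitaK_dense M Ω hstd) ξ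
    rw [Submodule.starProjection_eq_self_iff.2 hξ] at h
    exact sub_eq_self.1 h.symm
  have horth : tomitaJ M Ω hstd ξ ∈ (mulI K)ᗮ := (Submodule.starProjection_apply_eq_zero_iff _).1 hQ
  have hre : (⟪tomitaJ M Ω hstd ξ, (I : ℂ) • η⟫_ℂ).re = 0 := by
    have h := Submodule.inner_left_of_mem_orthogonal (I_smul_mem_mulI hη) horth
    rwa [real_inner_eq_re] at h
  have him : (⟪tomitaJ M Ω hstd ξ, η⟫_ℂ).im = 0 := by
    rw [im_inner_eq_neg_re_inner_I_smul, hre, neg_zero]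
  rw [← inner_conj_symm]
  exact Complex.conj_eq_iff_im.2 him

/-- **`(y(JxJ)ω, ω) = (ω, x(JyJ)ω)` for `x, y ∈ M_s`** (ours: `⟪Ω, y JxJ Ω⟫ = ⟪x JyJ Ω, Ω⟫`).
[cite: RieffelVandaele1977, Lemma 4.9 (proof)] -/
theorem inner_conjJ_identity_sa {x y : H →L[ℂ] H} (hxM : x ∈ M) (hxsa : IsSelfAdjoint x)
    (hyM : y ∈ M) (hysa : IsSelfAdjoint y) :
    ⟪Ω, y (conjJ hstd x Ω)⟫_ℂ = ⟪x (conjJ hstd y Ω), Ω⟫_ℂ := by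
  have hxa : ∀ u v : H, ⟪u, x v⟫_ℂ = ⟪x u, v⟫_ℂ := fun u v => by
    rw [← adjoint_inner_left, ← star_eq_adjoint, hxsa.star_eq]
  have hya : ∀ u v : H, ⟪u, y v⟫_ℂ = ⟪y u, v⟫_ℂ := fun u v => by
    rw [← adjoint_inner_left, ← star_eq_adjoint, hysa.star_eq]
  rw [conjJ_apply_self, conjJ_apply_self, hya, inner_tomitaJ_swap,
    inner_tomitaJ_of_mem hstd (apply_mem_tomitaK hyM hysa) (apply_mem_tomitaK hxM hxsa), ← hxa]

/-- The identity `⟪Ω, y JxJ Ω⟫ = ⟪x JyJ Ω, Ω⟫` for all `x, y ∈ M` ("this last equation is linear in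
both `x` and `y`, and so holds actually for all `x, y ∈ M`"). [cite: RieffelVandaele1977, Lemma 4.9 (proof)] -/
theorem inner_conjJ_identity {x y : H →L[ℂ] H} (hxM : x ∈ M) (hyM : y ∈ M) :
    ⟪Ω, y (conjJ hstd x Ω)⟫_ℂ = ⟪x (conjJ hstd y Ω), Ω⟫_ℂ := by
  obtain ⟨x₁, x₂, hx₁M, hx₂M, hx₁sa, hx₂sa, hx, -⟩ := exists_sa_decomp M hxM
  obtain ⟨y₁, y₂, hy₁M, hy₂M, hy₁sa, hy₂sa, hy, -⟩ := exists_sa_decomp M hyM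
  have h11 := inner_conjJ_identity_sa hstd hx₁M hx₁sa hy₁M hy₁sa
  have h12 := inner_conjJ_identity_sa hstd hx₁M hx₁sa hy₂M hy₂sa
  have h21 := inner_conjJ_identity_sa hstd hx₂M hx₂sa hy₁M hy₁sa
  have h22 := inner_conjJ_identity_sa hstd hx₂M hx₂sa hy₂M hy₂sa
  subst hx hy
  simp only [conjJ_add, conjJ_smul, add_apply, smul_apply, _root_.neg_apply, map_add, map_smul,
    map_neg, inner_add_left, inner_add_right, inner_smul_left, inner_smul_right, inner_neg_left,
    inner_neg_right, Complex.conj_I, neg_smul, neg_mul]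
  linear_combination h11 - I * h21 + I * h12 - I ^ 2 * h22

/-- **`x(JyJ)ω = (JyJ)xω` for `x ∈ M`, `y ∈ M_s`** (tested against `M'ω`, using `JM'J ⊆ M`).
[cite: RieffelVandaele1977, Lemma 4.9 (proof)] -/
theorem apply_conjJ_self_comm {x y : H →L[ℂ] H} (hxM : x ∈ M) (hyM : y ∈ M) (hysa : IsSelfAdjoint y) :
    x (conjJ hstd y Ω) = conjJ hstd y (x Ω) := by
  set Y := conjJ hstd y with hY
  have hya : ∀ u v : H, ⟪u, y v⟫_ℂ = ⟪y u, v⟫_ℂ := fun u v => by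
    rw [← adjoint_inner_left, ← star_eq_adjoint, hysa.star_eq]
  -- first for self-adjoint `x`
  have hsa_case : ∀ x ∈ M, IsSelfAdjoint x → x (Y Ω) = Y (x Ω) := by
    intro x hxM hxsa
    have hxa : ∀ u v : H, ⟪u, x v⟫_ℂ = ⟪x u, v⟫_ℂ := fun u v => by
      rw [← adjoint_inner_left, ← star_eq_adjoint, hxsa.star_eq]
    have hcyc' : IsCyclicVector M.commutant Ω := hstd.2.isCyclicVector_commutant
    have key : ∀ y' ∈ M.commutant, ⟪y' Ω, x (Y Ω)⟫_ℂ = ⟪y' Ω, Y (x Ω)⟫_ℂ := by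
      intro y' hy'M
      have hY'M : conjJ hstd y' ∈ M := conjJ_mem hstd hy'M
      have hd := inner_conjJ_identity hstd hxM (mul_mem hyM hY'M)
      rw [conjJ_mul, conjJ_conjJ] at hd
      -- left side of `hd`
      have hl : ⟪Ω, (y * conjJ hstd y') (conjJ hstd x Ω)⟫_ℂ = ⟪y' Ω, x (Y Ω)⟫_ℂ := by
        rw [mul_apply_eq_comp, conjJ_apply, conjJ_apply_self, tomitaJ_tomitaJ, hya, inner_tomitaJ_swap,
          commutant_apply_comm hxM hy'M, ← conjJ_apply_self, hxa]
      -- right side of `hd`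
      have hr : ⟪x ((Y * y') Ω), Ω⟫_ℂ = ⟪y' Ω, Y (x Ω)⟫_ℂ := by
        rw [mul_apply_eq_comp, ← inner_conj_symm, hxa, hY, conjJ_apply, inner_tomitaJ_swap, ← hya]
        conv_lhs => rw [← tomitaJ_tomitaJ hstd (y (tomitaJ M Ω hstd (x Ω)))]
        rw [inner_tomitaJ_tomitaJ, ← conjJ_apply, inner_conj_symm]
      rw [← hl, ← hr, hd]
    have hc1 : Continuous fun a : H => ⟪a, x (Y Ω)⟫_ℂ := by fun_prop
    have hc2 : Continuous fun a : H => ⟪a, Y (x Ω)⟫_ℂ := by fun_prop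
    have heq := Continuous.ext_on hcyc' hc1 hc2 (by
      rintro _ ⟨y', rfl⟩
      exact key y' y'.2)
    exact ext_inner_left ℂ fun a => congrFun heq a
  obtain ⟨x₁, x₂, hx₁M, hx₂M, hx₁sa, hx₂sa, hx, -⟩ := exists_sa_decomp M hxM
  rw [hx, add_apply, smul_apply, hsa_case x₁ hx₁M hx₁sa, hsa_case x₂ hx₂M hx₂sa, add_apply, smul_apply,
    map_add, map_smul]

/-- **Lemma 4.9 for self-adjoint `y ∈ M`**: `J y J ∈ M'`. [cite: RieffelVandaele1977, Lemma 4.9] -/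
theorem conjJ_mem_commutant_of_sa {y : H →L[ℂ] H} (hyM : y ∈ M) (hysa : IsSelfAdjoint y) :
    conjJ hstd y ∈ M.commutant := by
  rw [VonNeumannAlgebra.mem_commutant_iff]
  intro x hxM
  refine hstd.1.ext_on fun z hzM => ?_
  rw [mul_apply_eq_comp, mul_apply_eq_comp, ← apply_conjJ_self_comm hstd hzM hyM hysa,
    ← mul_apply_eq_comp x z, apply_conjJ_self_comm hstd (mul_mem hxM hzM) hyM hysa, mul_apply_eq_comp]

/-- **Lemma 4.9**: `J M J ⊆ M'`. [cite: RieffelVandaele1977, Lemma 4.9] -/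
theorem conjJ_mem_commutant {y : H →L[ℂ] H} (hyM : y ∈ M) : conjJ hstd y ∈ M.commutant := by
  obtain ⟨y₁, y₂, h1M, h2M, h1sa, h2sa, hdec, -⟩ := exists_sa_decomp M hyM
  rw [hdec, conjJ_add, conjJ_smul]
  exact add_mem (conjJ_mem_commutant_of_sa hstd h1M h1sa)
    (M.commutant.toStarSubalgebra.smul_mem (conjJ_mem_commutant_of_sa hstd h2M h2sa) _)

/-! ### Theorem 4.2 -/

/-- `J Δ^{is} J = Δ^{is}`. [cite: RieffelVandaele1977, Prop. 3.3] -/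
theorem conjJ_modU (s : ℝ) : conjJ hstd (modU (tomitaK M Ω) s) = modU (tomitaK M Ω) s := by
  ext v
  rw [conjJ_apply, tomitaJ, modJ_modU, modJ_modJ]

/-- `J σ_t(X) J = σ_t(J X J)`. [cite: RieffelVandaele1977, Thm. 4.2 (proof)] -/
theorem conjJ_modU_conj (t : ℝ) (X : H →L[ℂ] H) :
    conjJ hstd (modU (tomitaK M Ω) t * X * modU (tomitaK M Ω) (-t)) =
      modU (tomitaK M Ω) t * conjJ hstd X * modU (tomitaK M Ω) (-t) := by
  simp only [conjJ_mul, conjJ_modU]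

include hstd in
/-- **Theorem 4.2**: `Δ^{it} M Δ^{−it} ⊆ M`. [cite: RieffelVandaele1977, Thm. 4.2] -/
theorem modU_conj_mem {A : H →L[ℂ] H} (hAM : A ∈ M) (t : ℝ) : (modU (tomitaK M Ω) t * A * modU (tomitaK M Ω) (-t)) ∈ M := by
  have h := modU_conj_conjJ_mem hstd (conjJ_mem_commutant hstd hAM) t
  rwa [conjJ_conjJ] at h

include hstd in
/-- **Theorem 4.2 (commutant)**: `Δ^{it} M' Δ^{−it} ⊆ M'` (`= J(Δ^{it} J M' J Δ^{−it})J ⊆ JMJ ⊆ M'`).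
[cite: RieffelVandaele1977, Thm. 4.2] -/
theorem modU_conj_mem_commutant {A' : H →L[ℂ] H} (hA'M : A' ∈ M.commutant) (t : ℝ) :
    (modU (tomitaK M Ω) t * A' * modU (tomitaK M Ω) (-t)) ∈ M.commutant := by
  have h := conjJ_mem_commutant hstd (modU_conj_conjJ_mem hstd hA'M t)
  rwa [conjJ_modU_conj, conjJ_conjJ] at h

/-! ### The modular (KMS) condition (Theorem 4.10) -/

include hstd in
/-- **The KMS condition for `ω = ⟨Ω, ·Ω⟩` and `σ_t = Ad Δ^{it}` on `M`** (strip `0 ≤ Im z ≤ 1`,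
`G(t) = ⟨Ω, σ_t(A)BΩ⟩`, `G(t + i) = ⟨Ω, Bσ_t(A)Ω⟩`), by polarisation of Prop. 3.7.
[cite: RieffelVandaele1977, Thm. 4.10] [cite: Haag1996, V.2.1, (V.2.14)] -/
theorem kms_of_mem {A B : H →L[ℂ] H} (hAM : A ∈ M) (hBM : B ∈ M) :
    ∃ G : ℂ → ℂ, ContinuousOn G modularStrip ∧ DifferentiableOn ℂ G modularStripInterior ∧
      (∃ C : ℝ, ∀ z ∈ modularStrip, ‖G z‖ ≤ C) ∧
      (∀ t : ℝ, G t = ⟪Ω, (modU (tomitaK M Ω) t * A * star (modU (tomitaK M Ω) t) * B) Ω⟫_ℂ) ∧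
      (∀ t : ℝ, G (t + Complex.I) = ⟪Ω, (B * (modU (tomitaK M Ω) t * A * star (modU (tomitaK M Ω) t))) Ω⟫_ℂ) := by
  have hsep := tomitaK_sep M Ω hstd
  have hdense := tomitaK_dense M Ω hstd
  obtain ⟨A₁, A₂, hA₁M, hA₂M, hA₁sa, hA₂sa, hA, -⟩ := exists_sa_decomp M hAM
  obtain ⟨B₁, B₂, hB₁M, hB₂M, hB₁sa, hB₂sa, hB, -⟩ := exists_sa_decomp M hBM
  have hA₁K : A₁ Ω ∈ tomitaK M Ω := apply_mem_tomitaK hA₁M hA₁sa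
  have hA₂K : A₂ Ω ∈ tomitaK M Ω := apply_mem_tomitaK hA₂M hA₂sa
  have hB₁K : B₁ Ω ∈ tomitaK M Ω := apply_mem_tomitaK hB₁M hB₁sa
  have hB₂K : B₂ Ω ∈ tomitaK M Ω := apply_mem_tomitaK hB₂M hB₂sa
  set F : H → H → ℂ → ℂ := fun ξ η => kmsFun (tomitaK M Ω) hsep hdense ξ η with hF
  refine ⟨fun z => F (A₁ Ω) (B₁ Ω) z + I * F (A₁ Ω) (B₂ Ω) z + I * F (A₂ Ω) (B₁ Ω) z - F (A₂ Ω) (B₂ Ω) z,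
    ?_, ?_, ?_, ?_, ?_⟩
  · have hc := fun ξ η => continuous_kmsFun (tomitaK M Ω) hsep hdense ξ η
    exact Continuous.continuousOn (by simp only [hF]; fun_prop)
  · have hd := fun ξ η => differentiableOn_kmsFun (tomitaK M Ω) hsep hdense ξ η
    have hd' : ∀ ξ η, DifferentiableOn ℂ (F ξ η) modularStripInterior := fun ξ η => hd ξ η
    exact (((hd' _ _).add ((hd' _ _).const_mul _)).add ((hd' _ _).const_mul _)).sub (hd' _ _)
  · set bnd : H → H → ℝ := fun ξ η => 4⁻¹ * (2 * ‖zetaVec (tomitaK M Ω) hsep hdense η + zetaVec (tomitaK M Ω) hsep hdense ξ‖ ^ 2 +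
        2 * ‖zetaVec (tomitaK M Ω) hsep hdense η + I • zetaVec (tomitaK M Ω) hsep hdense ξ‖ ^ 2 +
        2 * ‖zetaVec (tomitaK M Ω) hsep hdense η - zetaVec (tomitaK M Ω) hsep hdense ξ‖ ^ 2 +
        2 * ‖zetaVec (tomitaK M Ω) hsep hdense η - I • zetaVec (tomitaK M Ω) hsep hdense ξ‖ ^ 2) with hbnd
    have hb : ∀ ξ η z, ‖F ξ η z‖ ≤ bnd ξ η := fun ξ η z => norm_kmsFun_le (tomitaK M Ω) hsep hdense ξ η z
    refine ⟨bnd (A₁ Ω) (B₁ Ω) + bnd (A₁ Ω) (B₂ Ω) + bnd (A₂ Ω) (B₁ Ω) + bnd (A₂ Ω) (B₂ Ω), fun z _ => ?_⟩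
    calc _ ≤ ‖F (A₁ Ω) (B₁ Ω) z‖ + ‖I * F (A₁ Ω) (B₂ Ω) z‖ + ‖I * F (A₂ Ω) (B₁ Ω) z‖ + ‖F (A₂ Ω) (B₂ Ω) z‖ :=
          norm_sub_le_of_le norm_add₃_le le_rfl
      _ ≤ _ := by
          rw [norm_mul, norm_mul, Complex.norm_I, one_mul, one_mul]
          gcongr <;> exact hb _ _ _
  · intro t
    beta_reduce
    have hF' : ∀ {ξ η : H}, ξ ∈ tomitaK M Ω → η ∈ tomitaK M Ω → F ξ η t = ⟪ξ, modU (tomitaK M Ω) (-t) η⟫_ℂ := fun hξ hη =>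
      kmsFun_ofReal (tomitaK M Ω) hsep hdense hξ hη t
    rw [hF' hA₁K hB₁K, hF' hA₁K hB₂K, hF' hA₂K hB₁K, hF' hA₂K hB₂K]
    -- right-hand side
    have hU : ∀ v : H, ⟪Ω, modU (tomitaK M Ω) t v⟫_ℂ = ⟪Ω, v⟫_ℂ := fun v => by
      rw [← adjoint_inner_left, ← star_eq_adjoint, star_modU,
        modU_apply_of_modR_apply_eq (tomitaK M Ω) modR_tomitaK_self]
    have hA₁a : ∀ u v : H, ⟪u, A₁ v⟫_ℂ = ⟪A₁ u, v⟫_ℂ := fun u v => by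
      rw [← adjoint_inner_left, ← star_eq_adjoint, hA₁sa.star_eq]
    have hA₂a : ∀ u v : H, ⟪u, A₂ v⟫_ℂ = ⟪A₂ u, v⟫_ℂ := fun u v => by
      rw [← adjoint_inner_left, ← star_eq_adjoint, hA₂sa.star_eq]
    rw [star_modU, mul_apply_eq_comp, mul_apply_eq_comp, mul_apply_eq_comp, hU, hA, hB]
    simp only [add_apply, smul_apply, map_add, map_smul, inner_add_right, inner_smul_right, hA₁a, hA₂a]
    linear_combination (-⟪A₂ Ω, modU (tomitaK M Ω) (-t) (B₂ Ω)⟫_ℂ) * I_sq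
  · intro t
    beta_reduce
    have hF' : ∀ {ξ η : H}, ξ ∈ tomitaK M Ω → η ∈ tomitaK M Ω → F ξ η (t + I) = ⟪η, modU (tomitaK M Ω) t ξ⟫_ℂ := fun hξ hη =>
      kmsFun_ofReal_add_I (tomitaK M Ω) hsep hdense hξ hη t
    rw [hF' hA₁K hB₁K, hF' hA₁K hB₂K, hF' hA₂K hB₁K, hF' hA₂K hB₂K]
    have hB₁a : ∀ u v : H, ⟪u, B₁ v⟫_ℂ = ⟪B₁ u, v⟫_ℂ := fun u v => by
      rw [← adjoint_inner_left, ← star_eq_adjoint, hB₁sa.star_eq]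
    have hB₂a : ∀ u v : H, ⟪u, B₂ v⟫_ℂ = ⟪B₂ u, v⟫_ℂ := fun u v => by
      rw [← adjoint_inner_left, ← star_eq_adjoint, hB₂sa.star_eq]
    rw [star_modU, mul_apply_eq_comp, mul_apply_eq_comp, mul_apply_eq_comp,
      modU_apply_of_modR_apply_eq (tomitaK M Ω) modR_tomitaK_self, hA, hB]
    simp only [add_apply, smul_apply, map_add, map_smul, inner_add_right, inner_smul_right, hB₁a, hB₂a]
    linear_combination (-⟪B₂ Ω, modU (tomitaK M Ω) t (A₂ Ω)⟫_ℂ) * I_sq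

/-! ### Assembly: the modular data of `(M, Ω)` and Haag's Theorem V.2.1.1 -/

include hstd in
/-- **The modular data of `(M, Ω)` exist** (`U(t) = Δ^{it}` of `𝒦 = closure(M_sa Ω)`, `J` its
conjugation): Tomita–Takesaki (Haag Thm. V.2.1.1, (V.2.6), (V.2.9), (V.2.14)) via Rieffel–van Daele
§§2–4. [cite: RieffelVandaele1977, Thm. 4.2 and Thm. 4.10] [cite: Haag1996, V.2.1, Thm. 2.1.1] -/
theorem exists_modularData : Nonempty (ModularData M Ω) :=
  ⟨{ U := modU (tomitaK M Ω)
     J := tomitaJ M Ω hstd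
     U_mem_unitary := modU_mem_unitary (tomitaK M Ω)
     U_zero := modU_zero (tomitaK M Ω)
     U_add := modU_add (tomitaK M Ω)
     continuous_U := continuous_modU_apply (tomitaK M Ω)
     U_apply_Ω := fun t => modU_apply_of_modR_apply_eq (tomitaK M Ω) modR_tomitaK_self t
     J_apply_Ω := tomitaJ_self hstd
     J_involutive := tomitaJ_tomitaJ hstd
     J_add := fun x y => map_add _ x y
     J_smul := fun c x => LinearIsometryEquiv.map_smulₛₗ _ c x
     inner_J_J := inner_tomitaJ_tomitaJ hstd
     J_U_comm := fun t x => modJ_modU (tomitaK M Ω) _ _ t x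
     U_conj_mem := fun t A hA => by rw [star_modU]; exact modU_conj_mem hstd hA t
     U_conj_mem_commutant := fun t A hA => by rw [star_modU]; exact modU_conj_mem_commutant hstd hA t
     J_conj_mem_commutant := fun A hA => ⟨conjJ hstd A, conjJ_mem_commutant hstd hA, fun x => rfl⟩
     J_conj_mem := fun A hA => ⟨conjJ hstd A, conjJ_mem hstd hA, fun x => rfl⟩
     kms := fun A hA B hB => kms_of_mem hstd hA hB }⟩

/-- **Tomita–Takesaki existence theorem** (Haag 1996, Thm. V.2.1.1 with (V.2.6), (V.2.9), (V.2.14)):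
the named fact `TomitaTakesaki_exists_modularData` of
`Literature.MathematicalPhysics.AQFT.ModularData`, proved following Rieffel–van Daele 1977.
[cite: Haag1996, V.2.1, Thm. 2.1.1] [cite: RieffelVandaele1977, Thm. 4.2 and Thm. 4.10] -/
theorem TomitaTakesaki_exists_modularData_holds : TomitaTakesaki_exists_modularData :=
  fun _H _ _ _ _M _Ω hstd => exists_modularData hstd

end Literature.MathematicalPhysics.AQFT
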